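import Mathlib
import Literature.Analysis.Calculus.LocalDegreeFormula

/-!
# Stability of a non-degenerate zero (Kronecker existence theorem, step K1)

Crux `WitnessCharge` (stmt-SmoothPoincare4-7824), route `SullivanDual`, line Sketch. The F5
programme (McDuff's cusp theorem via the twisted difference map of a `J`-holomorphic curve) uses a
Kronecker existence theorem on sup-norm cubes of `ℝⁿ⁺¹` (`Fin (n + 1) → ℝ`); its comparison step
shifts the value `0` of a `C¹` model `P` to a small regular value `c`. This file provides the
stability of a non-degenerate zero under that shift: if `P z = 0` and `det DP(z) ≠ 0`, then on a
small ball around `z` the Jacobian determinant does not vanish and keeps its sign, and every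
sufficiently small value `c` has exactly one preimage in that ball.

Proof: continuity of `x ↦ det DP(x)` (`ContinuousLinearMap.continuous_det`) gives the sign
constancy through `Literature.Analysis.Calculus.sign_eq_sign_of_abs_sub_lt`; the inverse function
theorem (`HasStrictFDerivAt.toOpenPartialHomeomorph`, after turning `DP(z)` into a continuous
linear equivalence with `ContinuousLinearMap.toContinuousLinearEquivOfDetNeZero`) gives
injectivity of `P` on a neighbourhood of `z` and, through
`HasStrictFDerivAt.map_nhds_eq_of_equiv`, that `P '' ball z ε` is a neighbourhood of `P z = 0`.

Mathlib and `Literature/Analysis/Calculus/LocalDegreeFormula.lean` only; no definitions,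
no `sorry`.
-/

noncomputable section

-- the summit path `SmoothPoincare4/SmoothPoincare4` forces a duplicated namespace segment
set_option linter.dupNamespace false

open Set Filter Metric Function
open scoped Topology

namespace Summit.SmoothPoincare4.SmoothPoincare4.Theorems.WitnessCharge.PencilIncompleteness

/-- **K1 — stability of a non-degenerate zero.** Let `P : ℝⁿ⁺¹ → ℝⁿ⁺¹` be `C¹` with `P z = 0`
and `det DP(z) ≠ 0`. Then there are `ε > 0` and `η > 0` such that `det DP(x) ≠ 0` and
`sign det DP(x) = sign det DP(z)` for every `x ∈ ball z ε`, and every value `c` with `‖c‖ < η`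
has exactly one preimage under `P` in `ball z ε` (continuity of `det DP` and the inverse function
theorem). -/
theorem helper_kronecker_stableZero :
    ∀ (n : ℕ) (P : (Fin (n + 1) → ℝ) → (Fin (n + 1) → ℝ)) (z : Fin (n + 1) → ℝ),
      ContDiff ℝ 1 P → P z = 0 → (fderiv ℝ P z).det ≠ 0 →
      ∃ ε : ℝ, 0 < ε ∧ ∃ η : ℝ, 0 < η ∧
        (∀ x ∈ Metric.ball z ε, (fderiv ℝ P x).det ≠ 0 ∧
          Real.sign (fderiv ℝ P x).det = Real.sign (fderiv ℝ P z).det) ∧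
        (∀ c : Fin (n + 1) → ℝ, ‖c‖ < η →
          ∃ x ∈ Metric.ball z ε, P x = c ∧ ∀ y ∈ Metric.ball z ε, P y = c → y = x) := by
  intro n P z hP hz hdet
  -- continuity of the Jacobian determinant
  have hdetc : Continuous fun x => (fderiv ℝ P x).det :=
    ContinuousLinearMap.continuous_det.comp (hP.continuous_fderiv one_ne_zero)
  -- the derivative at `z` as a continuous linear equivalence, and the strict derivative
  obtain ⟨A, hAe⟩ : ∃ A : (Fin (n + 1) → ℝ) ≃L[ℝ] (Fin (n + 1) → ℝ),
      (A : (Fin (n + 1) → ℝ) →L[ℝ] (Fin (n + 1) → ℝ)) = fderiv ℝ P z :=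
    ⟨_, (fderiv ℝ P z).coe_toContinuousLinearEquivOfDetNeZero hdet⟩
  have hsd : HasStrictFDerivAt P (A : (Fin (n + 1) → ℝ) →L[ℝ] (Fin (n + 1) → ℝ)) z := by
    rw [hAe]
    exact hP.contDiffAt.hasStrictFDerivAt one_ne_zero
  -- inverse function theorem: `P` restricted to a neighbourhood of `z` is a homeomorphism
  set Φ := hsd.toOpenPartialHomeomorph P
  have hsrc : Φ.source ∈ 𝓝 z :=
    Φ.open_source.mem_nhds hsd.mem_toOpenPartialHomeomorph_source
  -- near `z` the determinant is close to `det DP(z)`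
  have hsgn : ∀ᶠ x in 𝓝 z,
      |(fderiv ℝ P x).det - (fderiv ℝ P z).det| < |(fderiv ℝ P z).det| := by
    have h := Metric.tendsto_nhds.1 (hdetc.continuousAt (x := z)) _ (abs_pos.2 hdet)
    simpa [Real.dist_eq] using h
  obtain ⟨ε, hε, hball⟩ := Metric.mem_nhds_iff.1 (inter_mem hsrc hsgn)
  -- the image of the ball is a neighbourhood of `P z = 0`
  have himg : P '' ball z ε ∈ 𝓝 (0 : Fin (n + 1) → ℝ) := by
    rw [← hz, ← hsd.map_nhds_eq_of_equiv]
    exact image_mem_map (ball_mem_nhds z hε)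
  obtain ⟨η, hη, hηsub⟩ := Metric.mem_nhds_iff.1 himg
  have hinj : InjOn P (ball z ε) := Φ.injOn.mono fun w hw => (hball hw).1
  refine ⟨ε, hε, η, hη, fun x hx => ?_, fun c hc => ?_⟩
  · have hx' : |(fderiv ℝ P x).det - (fderiv ℝ P z).det| < |(fderiv ℝ P z).det| :=
      (hball hx).2
    refine ⟨fun h0 => ?_, Literature.Analysis.Calculus.sign_eq_sign_of_abs_sub_lt hx'⟩
    rw [h0, zero_sub, abs_neg] at hx'
    exact lt_irrefl _ hx'
  · obtain ⟨x, hx, hxc⟩ := hηsub (mem_ball_zero_iff.2 hc)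
    exact ⟨x, hx, hxc, fun y hy hyc => hinj hy hx (hyc.trans hxc.symm)⟩

end Summit.SmoothPoincare4.SmoothPoincare4.Theorems.WitnessCharge.PencilIncompleteness
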